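import Summits.Ventures.PercRepro.ProfilePointedCircuitClassesInOutTriangleCross

/-!
# PercRepro — A SINGLE SHORT CIRCUIT THROUGH `e`: THE REDUCTION OF `InOutBottomFour` TO `(★_C)` ON THE DELETION,
AND THE 4-CIRCUIT CASE AT `ρ = 6` WHEN `E − C` IS DEPENDENT (p5, gen 39; `proofs/P5-GM1.md` §58)

For a point `e` of `#E = ρ + 4` whose only circuit with `≤ ρ − 1` elements is `C = {e} ∪ C₀`, the in–out inequality
`in_4(e) ≤ out_5(e)` follows from the comparison `(★_C)` on the nullity-`3` deletion `M = N ∖ e`: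
`#{Y ∈ BI_3(M) : C₀ ⊄ Y} ≤ #{Z ∈ BI_5(M) : Z ∩ C₀ ≠ ∅}` (`inCount_four_le_card_filter_biIndepSets_three_delete`,
`card_filter_biIndepSets_five_delete_le_outCount_five`, `inCount_four_le_outCount_five_of_single_circuit`) — the
bi-independent `4`-sets through `e` lose `e`, and a bi-independent `5`-set of `M` meeting `C₀` is bi-independent in
`N` because `e ∉ cl(E − e − Z)` (every independent `(ρ − 2)`-set capturing `e` contains `C₀`).

At `ρ = 6` and `#C₀ = 3`, `(★_C)` reads, by complementation `BI_5 ≅ BI_4`, `P_3 − c₃ ≤ P_4 − u₃` with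
`c₃ = [C₀ ∈ BI_3]` and `u₃ = #{V ∈ BI_4 : C₀ ⊆ V}`; the kernel's bottom step `6·P_3 ≤ 4·P_4` and the count
`2·u₃ ≤ P_3` (every bi-independent `4`-set `V ⊇ C₀` contains at least two bi-independent `3`-sets — a spanning
`4`-set of the dual has at most two bad points — and a `3`-set `Y ≠ C₀` lies in at most one such `V = Y ∪ C₀`)
prove it when `c₃ = 0`, i.e. when `E − C` is dependent (`star_core_of_nine_of_not_biIndep`,
**`inCount_four_le_outCount_five_of_fourCircuit_of_six`**).
-/

open scoped Matroid

namespace PercRepro.Cogirth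

open Finset ThmH Skew Shadow Profile

variable {α : Type} [DecidableEq α]

section Reduction

variable {N : Matroid α} [N.Finite]

/-- `in_4(e) ≤ #{Y ∈ BI_3(N ∖ e) : C₀ ⊄ Y}` when `e ∈ cl(C₀)`. -/
theorem inCount_four_le_card_filter_biIndepSets_three_delete {e : α} {C₀ : Finset α} (hcl : e ∈ clF N C₀) :
    inCount N 4 e ≤ ((biIndepSets (N ＼ ({e} : Set α)) 3).filter (fun Y => ¬ C₀ ⊆ Y)).card := by
  unfold inCount
  apply card_le_card_of_injOn (fun W => W.erase e)
  · intro W hW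
    rw [mem_coe, mem_filter, mem_biIndepSets] at hW
    obtain ⟨⟨hWg, hW4, hWrk, hWc⟩, heW⟩ := hW
    have hWe : W.erase e ⊆ (gr N).erase e := erase_subset_erase e hWg
    have e1 : (gr N).erase e \ W.erase e = gr N \ W := by
      ext a
      simp only [mem_sdiff, mem_erase]
      constructor
      · rintro ⟨⟨hae, hag⟩, h⟩
        exact ⟨hag, fun haW => h ⟨hae, haW⟩⟩
      · rintro ⟨hag, haW⟩
        exact ⟨⟨fun h => haW (h ▸ heW), hag⟩, fun h => haW h.2⟩
    rw [mem_coe, mem_filter, mem_biIndepSets, gr_delete', rk_delete (M := N) (e := e) hWe,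
      rk_delete (M := N) (e := e) sdiff_subset, e1]
    beta_reduce
    refine ⟨⟨hWe, by rw [card_erase_of_mem heW, hW4], ?_, hWc⟩, ?_⟩
    · exact rk_eq_card_of_subset_of_rk_eq_card (erase_subset e W) hWrk
    · -- `C₀ ⊆ W − e` would put `e ∈ cl(W − e)`, against `W ∈ ℐ`
      intro hCW
      have heg : e ∈ gr N := hWg heW
      have hcl' : e ∈ clF N (W.erase e) := clF_mono hCW hcl
      rw [mem_clF_iff_rk_insert heg (hWe.trans (erase_subset _ _)), insert_erase heW] at hcl'
      have := rk_eq_card_of_subset_of_rk_eq_card (erase_subset e W) hWrk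
      rw [card_erase_of_mem heW] at this
      omega
  · intro W₁ hW₁ W₂ hW₂ h
    rw [mem_coe, mem_filter] at hW₁ hW₂
    rw [← insert_erase hW₁.2, ← insert_erase hW₂.2]
    exact congrArg (insert e) h

/-- `#{Z ∈ BI_5(N ∖ e) : Z ∩ C₀ ≠ ∅} ≤ out_5(e)` when every independent `(ρ − 2)`-subset of `E − e` capturing `e`
contains `C₀`. -/
theorem card_filter_biIndepSets_five_delete_le_outCount_five (hn : (gr N).card = rk N (gr N) + 4) {e : α}
    (he : e ∈ gr N) {C₀ : Finset α}
    (honly : ∀ X ⊆ (gr N).erase e, X.card + 2 = rk N (gr N) → rk N X = X.card → e ∈ clF N X → C₀ ⊆ X) :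
    ((biIndepSets (N ＼ ({e} : Set α)) 5).filter (fun Z => ¬ Disjoint Z C₀)).card ≤ outCount N 5 e := by
  unfold outCount
  apply card_le_card_of_injOn (fun Z => Z)
  · intro Z hZ
    rw [mem_coe, mem_filter, mem_biIndepSets, gr_delete'] at hZ
    obtain ⟨⟨hZg, hZ5, hZrk, hZc⟩, hZC⟩ := hZ
    rw [rk_delete (M := N) (e := e) hZg] at hZrk
    rw [rk_delete (M := N) (e := e) sdiff_subset] at hZc
    have heZ : e ∉ Z := fun h => (mem_erase.1 (hZg h)).1 rfl
    have e1 : gr N \ Z = insert e ((gr N).erase e \ Z) := by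
      ext a
      simp only [mem_sdiff, mem_insert, mem_erase]
      constructor
      · rintro ⟨hag, haZ⟩
        by_cases hae : a = e
        · exact Or.inl hae
        · exact Or.inr ⟨⟨hae, hag⟩, haZ⟩
      · rintro (rfl | ⟨⟨_, hag⟩, haZ⟩)
        · exact ⟨he, heZ⟩
        · exact ⟨hag, haZ⟩
    have hXcard : ((gr N).erase e \ Z).card + 2 = rk N (gr N) := by
      have h6 := card_le_card hZg
      rw [card_erase_of_mem he, hZ5] at h6
      rw [card_sdiff_of_subset hZg, card_erase_of_mem he, hZ5]
      omega
    have hecl : e ∉ clF N ((gr N).erase e \ Z) := by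
      intro h
      have := honly _ sdiff_subset hXcard hZc h
      exact hZC (disjoint_left.2 fun a haZ haC => (mem_sdiff.1 (this haC)).2 haZ)
    rw [mem_coe, mem_filter, mem_biIndepSets]
    refine ⟨⟨hZg.trans (erase_subset _ _), hZ5, hZrk, ?_⟩, heZ⟩
    rw [e1, rk_insert_eq he (sdiff_subset.trans (erase_subset _ _)), if_neg hecl, hZc,
      card_insert_of_notMem (fun h => (mem_erase.1 (mem_sdiff.1 h).1).1 rfl)]
  · intro Z₁ _ Z₂ _ h
    exact h

/-- **THE SINGLE-CIRCUIT REDUCTION**: if `e ∈ cl(C₀)` and every independent `(ρ − 2)`-subset of `E − e` capturing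
`e` contains `C₀`, then `(★_C)` on the deletion — `#{Y ∈ BI_3(N ∖ e) : C₀ ⊄ Y} ≤ #{Z ∈ BI_5(N ∖ e) : Z ∩ C₀ ≠ ∅}` —
gives `in_4(e) ≤ out_5(e)`. -/
theorem inCount_four_le_outCount_five_of_single_circuit (hn : (gr N).card = rk N (gr N) + 4) {e : α}
    (he : e ∈ gr N) {C₀ : Finset α} (hcl : e ∈ clF N C₀)
    (honly : ∀ X ⊆ (gr N).erase e, X.card + 2 = rk N (gr N) → rk N X = X.card → e ∈ clF N X → C₀ ⊆ X)
    (hstar : ((biIndepSets (N ＼ ({e} : Set α)) 3).filter (fun Y => ¬ C₀ ⊆ Y)).card ≤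
      ((biIndepSets (N ＼ ({e} : Set α)) 5).filter (fun Z => ¬ Disjoint Z C₀)).card) :
    inCount N 4 e ≤ outCount N 5 e :=
  (inCount_four_le_card_filter_biIndepSets_three_delete hcl).trans
    (hstar.trans (card_filter_biIndepSets_five_delete_le_outCount_five hn he honly))

end Reduction

section NineCore

variable {R : Matroid α} [R.Finite]

/-- A spanning `4`-set of a loopless rank-`3` matroid has at least two `3`-subsets of rank `3` (at most two of its
points are bad). -/
theorem two_le_card_filter_rk_eq_three_of_four (hll : ∀ x ∈ gr R, rk R {x} = 1) {V : Finset α}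
    (hV : V ⊆ gr R) (hV4 : V.card = 4) (hVr : rk R V = 3) :
    2 ≤ ((V.powersetCard 3).filter (fun Y => rk R Y = 3)).card := by
  have hbad := card_filter_rk_erase_le_two_le_two hll hV hVr (by omega)
  have hgood : 2 ≤ (V.filter (fun v => ¬ rk R (V.erase v) ≤ 2)).card := by
    have := card_filter_add_card_filter_not (s := V) (fun v => rk R (V.erase v) ≤ 2)
    omega
  refine hgood.trans (card_le_card_of_injOn (fun v => V.erase v) ?_ ?_)
  · intro v hv
    rw [mem_coe, mem_filter] at hv
    rw [mem_coe, mem_filter, mem_powersetCard]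
    beta_reduce
    have h1 := rk_mono' (M := R) (erase_subset v V)
    exact ⟨⟨erase_subset v V, by rw [card_erase_of_mem hv.1, hV4]⟩, by omega⟩
  · intro v₁ hv₁ v₂ _ h
    rw [mem_coe, mem_filter] at hv₁
    exact (erase_inj V hv₁.1).1 h

variable {M : Matroid α} [M.Finite]

/-- **`(★_C)` AT NINE POINTS WHEN `C₀` IS NOT BI-INDEPENDENT**: on a coloop-free nullity-`3` matroid `M` on `9`
points and a `3`-set `C₀ ∉ BI_3(M)`, `#{Y ∈ BI_3(M) : C₀ ⊄ Y} ≤ #{Z ∈ BI_5(M) : Z ∩ C₀ ≠ ∅}`. -/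
theorem star_core_of_nine_of_not_biIndep (hn : (gr M).card = rk M (gr M) + 3) (h9 : (gr M).card = 9)
    (hcf : ∀ x ∈ gr M, rk M ((gr M).erase x) = rk M (gr M)) {C₀ : Finset α} (hC : C₀ ⊆ gr M)
    (hC3 : C₀.card = 3) (hCn : C₀ ∉ biIndepSets M 3) :
    ((biIndepSets M 3).filter (fun Y => ¬ C₀ ⊆ Y)).card ≤
      ((biIndepSets M 5).filter (fun Z => ¬ Disjoint Z C₀)).card := by
  have hgrR : gr M✶ = gr M := gr_dual
  have hR3 : rk M✶ (gr M) = 3 := rk_dual_gr_of_nullity_three hn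
  have hllR : ∀ x ∈ gr M✶, rk M✶ {x} = 1 := by
    intro x hx
    rw [hgrR] at hx
    exact rk_dual_singleton_of_coloopFree hcf hx
  -- (i) the units are the bi-independent `4`-sets not containing `C₀`, by complementation
  have hU : ((biIndepSets M 5).filter (fun Z => ¬ Disjoint Z C₀)).card =
      ((biIndepSets M 4).filter (fun V => ¬ C₀ ⊆ V)).card := by
    apply card_bij (fun Z _ => gr M \ Z)
    · intro Z hZ
      rw [mem_filter, mem_biIndepSets] at hZ
      obtain ⟨⟨hZg, hZ5, hZr, hZc⟩, hZC⟩ := hZ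
      rw [mem_filter, mem_biIndepSets]
      refine ⟨⟨sdiff_subset, ?_, hZc, ?_⟩, ?_⟩
      · rw [card_sdiff_of_subset hZg, hZ5, h9]
      · rw [Finset.sdiff_sdiff_eq_self hZg]; exact hZr
      · intro hCZ
        exact hZC (disjoint_left.2 fun a haZ haC => (mem_sdiff.1 (hCZ haC)).2 haZ)
    · intro Z₁ hZ₁ Z₂ hZ₂ h
      have h₁ : Z₁ ⊆ gr M := (mem_biIndepSets.1 (mem_filter.1 hZ₁).1).1
      have h₂ : Z₂ ⊆ gr M := (mem_biIndepSets.1 (mem_filter.1 hZ₂).1).1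
      rw [← Finset.sdiff_sdiff_eq_self h₁, ← Finset.sdiff_sdiff_eq_self h₂, h]
    · intro V hV
      rw [mem_filter, mem_biIndepSets] at hV
      obtain ⟨⟨hVg, hV4, hVr, hVc⟩, hVC⟩ := hV
      refine ⟨gr M \ V, ?_, Finset.sdiff_sdiff_eq_self hVg⟩
      rw [mem_filter, mem_biIndepSets]
      refine ⟨⟨sdiff_subset, ?_, hVc, ?_⟩, ?_⟩
      · rw [card_sdiff_of_subset hVg, hV4, h9]
      · rw [Finset.sdiff_sdiff_eq_self hVg]; exact hVr
      · intro hd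
        apply hVC
        intro a haC
        by_contra haV
        exact disjoint_left.1 hd (mem_sdiff.2 ⟨hC haC, haV⟩) haC
  -- (ii) `#{V ∈ BI_4 : C₀ ⊄ V} = P_4 − u₃`
  have hsplit := card_filter_add_card_filter_not (s := biIndepSets M 4) (fun V => C₀ ⊆ V)
  -- (iii) `2·u₃ ≤ P_3`: every `V ⊇ C₀` has two bi-independent `3`-subsets, each in at most one `V`
  have hu : ((biIndepSets M 4).filter (fun V => C₀ ⊆ V)).card * 2 ≤ (biIndepSets M 3).card * 1 := by
    refine card_mul_le_card_mul (fun (V Y : Finset α) => Y ⊆ V) ?_ ?_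
    · intro V hV
      rw [mem_filter, mem_biIndepSets] at hV
      obtain ⟨⟨hVg, hV4, hVr, hVc⟩, _⟩ := hV
      -- `V` spans the dual
      have hVR : rk M✶ V = 3 := by
        have := (rk_eq_card_iff_rk_dual_sdiff (M := M) (X := gr M \ V) sdiff_subset).1 hVc
        rwa [Finset.sdiff_sdiff_eq_self hVg, hR3] at this
      have h2 := two_le_card_filter_rk_eq_three_of_four hllR (by rw [hgrR]; exact hVg) hV4 hVR
      refine h2.trans (card_le_card ?_)
      intro Y hY
      rw [mem_filter, mem_powersetCard] at hY
      rw [mem_bipartiteAbove, mem_biIndepSets]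
      refine ⟨⟨hY.1.1.trans hVg, hY.1.2, rk_eq_card_of_subset_of_rk_eq_card hY.1.1 hVr, ?_⟩, hY.1.1⟩
      rw [rk_eq_card_iff_rk_dual_sdiff (M := M) (X := gr M \ Y) sdiff_subset,
        Finset.sdiff_sdiff_eq_self (hY.1.1.trans hVg), hR3]
      exact hY.2
    · intro Y hY
      rw [mem_biIndepSets] at hY
      apply card_le_one.2
      intro V₁ hV₁ V₂ hV₂
      rw [mem_bipartiteBelow, mem_filter, mem_biIndepSets] at hV₁ hV₂
      have hYC : Y ≠ C₀ := fun h => hCn (h ▸ mem_biIndepSets.2 hY)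
      -- `V = Y ∪ C₀` for every such `V`
      have key : ∀ V, V ∈ biIndepSets M 4 → C₀ ⊆ V → Y ⊆ V → V = Y ∪ C₀ := by
        intro V hV hCV hYV
        rw [mem_biIndepSets] at hV
        have hsub : Y ∪ C₀ ⊆ V := union_subset hYV hCV
        have hcard : 4 ≤ (Y ∪ C₀).card := by
          by_contra hlt
          have hle : (Y ∪ C₀).card ≤ 3 := by omega
          have h1 := card_le_card (subset_union_left (s₁ := Y) (s₂ := C₀))
          have h2 := card_le_card (subset_union_right (s₁ := Y) (s₂ := C₀))
          have hYeq : Y = Y ∪ C₀ := eq_of_subset_of_card_le subset_union_left (by omega)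
          have hCeq : C₀ = Y ∪ C₀ := eq_of_subset_of_card_le subset_union_right (by omega)
          exact hYC (hYeq.trans hCeq.symm)
        exact (eq_of_subset_of_card_le hsub (by omega)).symm
      rw [key V₁ (mem_biIndepSets.2 hV₁.1.1) hV₁.1.2 hV₁.2, key V₂ (mem_biIndepSets.2 hV₂.1.1) hV₂.1.2 hV₂.2]
  -- (iv) the kernel's bottom step `6·P_3 ≤ 4·P_4`
  have hstep := biIndep_step_three_of_nullity_three (N := M) hn (by omega)
  rw [h9] at hstep
  -- (v) assemble
  have hD : ((biIndepSets M 3).filter (fun Y => ¬ C₀ ⊆ Y)).card ≤ (biIndepSets M 3).card :=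
    card_le_card (filter_subset _ _)
  rw [hU]
  omega

end NineCore

section Assembly

variable {N : Matroid α} [N.Finite]

/-- **THE SINGLE 4-CIRCUIT CASE OF `InOutBottomFour` AT `ρ = 6`, WHEN `E − C` IS DEPENDENT**: on `#E = 10`,
`ρ(E) = 6`, with `E − e` free of loops and coloops, at a point `e` with `e ∈ cl(C₀)`, `#C₀ = 3`, such that every
independent `4`-subset of `E − e` capturing `e` contains `C₀`, and with `E − e − C₀` dependent,
`in_4(e) ≤ out_5(e)`. -/
theorem inCount_four_le_outCount_five_of_fourCircuit_of_six (hn : (gr N).card = rk N (gr N) + 4)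
    (hR : rk N (gr N) = 6) {e : α} (he : e ∈ gr N) (hnc : rk N ((gr N).erase e) = rk N (gr N))
    (hcf : ∀ x ∈ (gr N).erase e, rk N (((gr N).erase e).erase x) = rk N (gr N))
    {C₀ : Finset α} (hC : C₀ ⊆ (gr N).erase e) (hC3 : C₀.card = 3) (hcl : e ∈ clF N C₀)
    (honly : ∀ X ⊆ (gr N).erase e, X.card + 2 = rk N (gr N) → rk N X = X.card → e ∈ clF N X → C₀ ⊆ X)
    (hdep : rk N ((gr N).erase e \ C₀) ≠ ((gr N).erase e \ C₀).card) :
    inCount N 4 e ≤ outCount N 5 e := by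
  refine inCount_four_le_outCount_five_of_single_circuit hn he hcl honly ?_
  have hgr : gr (N ＼ ({e} : Set α)) = (gr N).erase e := gr_delete'
  have hrkM : rk (N ＼ ({e} : Set α)) ((gr N).erase e) = rk N (gr N) := by
    rw [rk_delete (M := N) (e := e) (Subset.refl ((gr N).erase e))]
    exact hnc
  have hnM : (gr (N ＼ ({e} : Set α))).card = rk (N ＼ ({e} : Set α)) (gr (N ＼ ({e} : Set α))) + 3 := by
    rw [hgr, hrkM, card_erase_of_mem he]
    omega
  have h9M : (gr (N ＼ ({e} : Set α))).card = 9 := by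
    rw [hgr, card_erase_of_mem he]
    omega
  have hcfM : ∀ x ∈ gr (N ＼ ({e} : Set α)),
      rk (N ＼ ({e} : Set α)) ((gr (N ＼ ({e} : Set α))).erase x) = rk (N ＼ ({e} : Set α)) (gr (N ＼ ({e} : Set α))) := by
    intro x hx
    rw [hgr] at hx
    rw [hgr, rk_delete (M := N) (e := e) (erase_subset _ _), hrkM]
    exact hcf x hx
  have hCM : C₀ ⊆ gr (N ＼ ({e} : Set α)) := by rw [hgr]; exact hC
  have hCn : C₀ ∉ biIndepSets (N ＼ ({e} : Set α)) 3 := by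
    intro h
    rw [mem_biIndepSets, hgr, rk_delete (M := N) (e := e) sdiff_subset] at h
    exact hdep h.2.2.2
  exact star_core_of_nine_of_not_biIndep hnM h9M hcfM hCM hC3 hCn

end Assembly

end PercRepro.Cogirth
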